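import Summits.BirchSwinnertonDyer.Rank1Residual.GaloisImage.KolyvaginDerivativeNormCompatible
import Summits.BirchSwinnertonDyer.Rank1Residual.GaloisImage.KolyvaginDerivativeUnramifiedClass
import HarnessLib

/-!
# Kolyvagin's derivative classes are local images of `T`-classes at every place absorbed by a
# cyclotomic layer — file 3 of row T-DER-BN (THEOREM B of row T-DER at the bad places `v ∣ N`:
# `loc_v κ_r ∈ im(H¹(K_v, T) → H¹(K_v, T/M)) = H¹_{𝓕can}(K_v, T/M)`)
# (cell `b2b-bsdres`, team n1011, seat p15 GEN 6; skeleton `cells/n1011/skel/T-DER-BN.md` §1 (S3)–(S4))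

HONEST FRAMING (cell `b2b-bsdres`, run/shared/lean/b2b/bsd-rank1-residual/, verbatim in every
file): the goal of the cell is to DELETE the COMBINATION-SHAPED residual classes of the
Birch–Swinnerton-Dyer formula for ALL analytic-rank `≤ 1` elliptic curves over `ℚ` — "full BSD
formula for every rank `≤ 1` curve in class `C`" assembled STRICTLY from published theorems — so
that the rank-`≤ 1` remainder becomes exactly the CONSTRUCTION-SHAPED classes, which are TYPED
(missing-input `Prop`s), NOT attempted. This is not "finishing BSD". Team n1011 (N10 / N11, the
additive block X4 ∧ `p = 3`): research route on the CONSTRUCTION-SHAPED class X4; no claim beyond the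
stated classes; nothing is booked. TOOL theorems (no definition, no named fact, no `sorry`);
curve-free and coefficient-ring-free; no hypothesis on `T` at the place in question.

## What

Data as in files 1–2 of the row: levels `L` (layers `Γ_i = L.pLevel i`, levels
`U_{i,r} = L.level i r`), classes `c_{i,r} ∈ H¹(U_{i,r}, T)`, a coefficient map `red : T ⟶ T′`,
`r`, `σ_ℓ, N_ℓ`, the derivative operator `D_r = ∏ Σ j σ_ℓ^j`, and a class `κ_i ∈ H¹(Γ_i, T′)` with
`res_{U_{i,r}} κ_i = D_r (red_* c_{i,r})` (file 2, `existsUnique_resLe_eq_deriv`).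

§1 `D_r` commutes with the action of any `g ∈ Γ_K` on `H¹(U_{i,r}, ·)` (`Γ_K / U_{i,r}` is
abelian) and with `red_*` (`conjMap_deriv_comm`, `map_red_deriv_comm`); hence EVERY conjugate
`g · κ_i` restricts on `U_{i,r}` into the image of `H¹(U_{i,r}, T)`
(`exists_map_red_eq_resLe_conjMap`).

§2 **THEOREM (local image, (S4))** `exists_map_red_eq_resSubgroup_cores`: for ANY subgroup
`D ≤ Γ_K` ABSORBED by the layer `i` over `K(r)` — `habs : D ⊓ Γ_i ≤ U_{⊥,r}`, i.e. for a
decomposition group `D = D_w`, `K(r)_w ⊆ K_{i,w}` — the restriction to `D` of `Cor_{K_i/K} κ_i`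
lies in the image of `H¹(D, T) → H¹(D, T′)`.  Proof: the Mackey formula (file 1,
`resSubgroup_cores_eq_sum_cores`) writes `res_D Cor κ_i` as a sum over the primes of `K_i` above
`w` of `cor^D_{D ∩ Γ_i} res (g · κ_i)`; by `habs`, `D ∩ Γ_i ≤ U_{i,r}`, so each restriction factors
through `res_{U_{i,r}} (g · κ_i) = red_*(D_r (g · c_{i,r}))`, and `red_*` commutes with `res`,
`toSubgroupOf` and `cor` (file 1 §1).  With file 2 (`Cor_{K_i/K} κ_i = κ_r`) this is
`loc_w κ_r ∈ im H¹(K_w, T)` at every finite `w ∤ p`, `w ∉ r` (bad places of `T` INCLUDED), once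
`i` is large enough that the unramified extension `K(r)_w/K_w` sits inside `K_{i,w_i}` — [Rubin00]
Thm. 4.5.1 at the primes of `Σ ∖ Σ_{pr}`, [MR04] Thm. 3.2.4's hypothesis "`𝒦` contains the maximal
abelian `p`-extension unramified outside `p𝒫`" at work.  The absorption hypothesis and the choice
of `i` for `cyclotomicLevelsRat` are file 4; no hypothesis on `T` at `w` is made here.

References: K. Rubin, *Euler Systems* (2000), Thm. 4.5.1 and §4.6; B. Mazur, K. Rubin, Mem. AMS
799 (2004), Thm. 3.2.4, App. A Prop. A.2; D. Burns, R. Sakamoto, T. Sano, IMRN (2019), §6.2.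
-/

noncomputable section

open CategoryTheory Function Finset Polynomial Field IsDedekindDomain
open scoped NumberField Classical
open Literature.NumberTheory.GaloisRepresentations
open Literature.NumberTheory.EllipticCurves (subgroupInclusion subgroupConj)

universe u v w

namespace Summit.BirchSwinnertonDyer.Rank1Residual.GaloisImage

namespace Derivative

section Commute

variable {R : Type u} [CommRing R] [TopologicalSpace R]
variable {G : Type v} [Group G] [TopologicalSpace G] [IsTopologicalGroup G]
variable {X Y : TopRep.{v} R G} (U : Subgroup G) [U.Normal]

variable (X) in
/-- **`g · D_r y = D_r (g · y)`** on `H¹(U, X)` when every commutator `g⁻¹ σ_ℓ⁻¹ g σ_ℓ` lies in `U`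
(e.g. `G ⧸ U` abelian). [folklore] -/
theorem conjMap_deriv_comm {κ : Type*} (s : Finset κ) (σ : κ → G) (N : κ → ℕ) (comm) (g : G)
    (hg : ∀ ℓ ∈ s, g⁻¹ * (σ ℓ)⁻¹ * g * σ ℓ ∈ U) (y : continuousCohomology 1 (subgroupRep X U)) :
    conjMap X U g 1 ((s.noncommProd (fun ℓ => ∑ j ∈ range (N ℓ),
        (j : Module.End R (continuousCohomology 1 (subgroupRep X U))) *
          (conjMap X U (σ ℓ) 1).hom.toLinearMap ^ j) comm) y) =
      (s.noncommProd (fun ℓ => ∑ j ∈ range (N ℓ),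
        (j : Module.End R (continuousCohomology 1 (subgroupRep X U))) *
          (conjMap X U (σ ℓ) 1).hom.toLinearMap ^ j) comm) (conjMap X U g 1 y) := by
  change (conjMap X U g 1).hom.toLinearMap _ = _
  rw [apply_noncommProd_apply_eq_of_comm (conjMap X U g 1).hom.toLinearMap s comm comm
    (fun ℓ hℓ v => apply_deriv_apply_eq_of_comm _
      (fun w => LinearMap.congr_fun (commute_conjMap_hom X (hg ℓ hℓ)).eq w) (N ℓ) v) y]
  rfl

/-- **`red_* (D_r y) = D_r (red_* y)`**: the derivative operator commutes with a change of
coefficients along an equivariant `red : X ⟶ Y`. [folklore] -/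
theorem map_red_deriv_comm {κ : Type*} (red : X ⟶ Y) (s : Finset κ) (σ : κ → G) (N : κ → ℕ)
    (comm) (comm') (y : continuousCohomology 1 (subgroupRep X U)) :
    ContinuousCohomology.map (ContinuousMonoidHom.id U) (X := subgroupRep X U) (Y := subgroupRep Y U)
        ((TopRep.resFunctor U.subtype).map red) 1
        ((s.noncommProd (fun ℓ => ∑ j ∈ range (N ℓ),
          (j : Module.End R (continuousCohomology 1 (subgroupRep X U))) *
            (conjMap X U (σ ℓ) 1).hom.toLinearMap ^ j) comm) y) =
      (s.noncommProd (fun ℓ => ∑ j ∈ range (N ℓ),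
          (j : Module.End R (continuousCohomology 1 (subgroupRep Y U))) *
            (conjMap Y U (σ ℓ) 1).hom.toLinearMap ^ j) comm')
        (ContinuousCohomology.map (ContinuousMonoidHom.id U) (X := subgroupRep X U)
          (Y := subgroupRep Y U) ((TopRep.resFunctor U.subtype).map red) 1 y) := by
  change (ContinuousCohomology.map (ContinuousMonoidHom.id U) (X := subgroupRep X U)
    (Y := subgroupRep Y U) ((TopRep.resFunctor U.subtype).map red) 1).hom.toLinearMap _ = _
  rw [apply_noncommProd_apply_eq_of_comm _ s comm comm'
    (fun ℓ _ v => apply_deriv_apply_eq_of_comm _ (fun w => red_conjMap red (σ ℓ) w) (N ℓ) v) y]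
  rfl

omit [U.Normal] in
/-- At the level of a subgroup `U`, the tree's `cohomologyMap` of the restricted coefficient map
is the coefficient change `H¹(U, X) → H¹(U, Y)` written with `resFunctor` (p11's currency).
[folklore] -/
theorem cohomologyMap_resFunctor_map (red : X ⟶ Y) (y : continuousCohomology 1 (subgroupRep X U)) :
    cohomologyMap ((TopRep.resFunctor U.subtype).map red) 1 y =
      ContinuousCohomology.map (ContinuousMonoidHom.id U) (X := subgroupRep X U)
        (Y := subgroupRep Y U) ((TopRep.resFunctor U.subtype).map red) 1 y := by
  obtain ⟨φ, rfl⟩ := oneCocycleClass_surjective _ y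
  rw [cohomologyMap_oneCocycleClass, map_oneCocycleClass]
  exact congrArg _ (Subtype.ext (ContinuousMap.ext fun _ => rfl))

end Commute

/-! ### §2 The local image theorem -/

section LocalImage

variable {K : Type u} [Field K] [NumberField K] {ι : Type w} [Preorder ι] [OrderBot ι]
variable {A : Type v} [CommRing A] [TopologicalSpace A]
variable {M : Type u} [AddCommGroup M] [Module A M] [TopologicalSpace M] [IsTopologicalAddGroup M]
  [ContinuousSMul A M]
variable {L : EulerSystemLevels K ι} {T : GaloisRep K A M}
variable {c : ∀ (i : ι) (r : L.Ideals), H1 T (L.level i r.1)}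
variable {M' : Type u} [AddCommGroup M'] [Module A M'] [TopologicalSpace M'] [IsTopologicalAddGroup M']
  [ContinuousSMul A M'] {T' : GaloisRep K A M'}

open scoped commutatorElement in
/-- Every conjugate `g · κ_i` of a layer-`i` derivative class restricts on `Gal(K̄/K_i(r))` into the
image of `H¹(K_i(r), T)`: `res (g · κ_i) = red_* (D_r (g · c_{i,r}))`. [folklore] -/
theorem resLe_conjMap_eq_map_red_deriv (red : T.toTopRep ⟶ T'.toTopRep) (i : ι) (r : L.Ideals)
    (σ : HeightOneSpectrum (𝓞 K) → absoluteGaloisGroup K) (N : HeightOneSpectrum (𝓞 K) → ℕ) (comm)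
    (κi : continuousCohomology 1 (subgroupRep T'.toTopRep (L.pLevel i)))
    (hκi : resLe T'.toTopRep (level_le_pLevel L i r.1) 1 κi =
        (r.1.noncommProd (fun ℓ => ∑ j ∈ range (N ℓ), (j : Module.End A (continuousCohomology 1
          (subgroupRep T'.toTopRep (L.level i r.1)))) *
          (conjMap T'.toTopRep (L.level i r.1) (σ ℓ) 1).hom.toLinearMap ^ j) comm)
        (ContinuousCohomology.map (ContinuousMonoidHom.id _) (X := subgroupRep T.toTopRep (L.level i r.1))
          (Y := subgroupRep T'.toTopRep (L.level i r.1))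
          ((TopRep.resFunctor (L.level i r.1).subtype).map red) 1 (c i r)))
    (g : absoluteGaloisGroup K) :
    haveI : (L.pLevel i).Normal :=
      Subgroup.Normal.of_commutator_le (absoluteGaloisGroup K) (L.commutator_le_pLevel i)
    resLe T'.toTopRep (level_le_pLevel L i r.1) 1 (conjMap T'.toTopRep (L.pLevel i) g 1 κi) =
      ContinuousCohomology.map (ContinuousMonoidHom.id _) (X := subgroupRep T.toTopRep (L.level i r.1))
        (Y := subgroupRep T'.toTopRep (L.level i r.1))
        ((TopRep.resFunctor (L.level i r.1).subtype).map red) 1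
        ((r.1.noncommProd (fun ℓ => ∑ j ∈ range (N ℓ), (j : Module.End A (continuousCohomology 1
          (subgroupRep T.toTopRep (L.level i r.1)))) *
          (conjMap T.toTopRep (L.level i r.1) (σ ℓ) 1).hom.toLinearMap ^ j)
          (pairwise_commute_deriv i r.1 σ N))
          (conjMap T.toTopRep (L.level i r.1) g 1 (c i r))) := by
  haveI : (L.pLevel i).Normal :=
    Subgroup.Normal.of_commutator_le (absoluteGaloisGroup K) (L.commutator_le_pLevel i)
  have hg : ∀ ℓ ∈ r.1, g⁻¹ * (σ ℓ)⁻¹ * g * σ ℓ ∈ L.level i r.1 := fun ℓ _ => by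
    refine L.commutator_le_level i r.1 ?_
    have e : g⁻¹ * (σ ℓ)⁻¹ * g * σ ℓ = ⁅g⁻¹, (σ ℓ)⁻¹⁆ := by
      rw [commutatorElement_def, inv_inv, inv_inv]
    rw [e, commutator_def]
    exact Subgroup.commutator_mem_commutator (Subgroup.mem_top _) (Subgroup.mem_top _)
  rw [resLe_conjMap, hκi, conjMap_deriv_comm T'.toTopRep (L.level i r.1) r.1 σ N comm g hg,
    ← red_conjMap, map_red_deriv_comm]

/-- **THEOREM (derivative classes are local images of `T`-classes at `p`-absorbed places;
THEOREM B of row T-DER at the places `v ∣ N`).**  Let `κ_i ∈ H¹(Gal(K̄/K_i), T′)` restrict on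
`Gal(K̄/K_i(r))` to `D_r (red_* c_{i,r})` (file 2, `existsUnique_resLe_eq_deriv`), and let
`D ≤ Γ_K` be a subgroup such that the index of `D ∩ Gal(K̄/K_i(r))` in `D ∩ Gal(K̄/K_i)` acts
invertibly on `T′` (`ha : (a · index) v = v`; for a decomposition group `D = D_w`, `w ∉ r`,
`w ∤ p`, and `T′` killed by `M = p^k`: the `p`-part of the residue degree of `K(r)_w / K_w` divides
that of `K_{i,w} / K_w` — unramified extensions of `K_w` are nested —, the prime-to-`p` part being
harmless).  Then `res_D (Cor_{K_i/K} κ_i) = red_* z` for some `z ∈ H¹(D, T)`.  With file 2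
(`cores_eq_of_resLe_eq_deriv`: `Cor_{K_i/K} κ_i = κ_r`) this is **`loc_w κ_r ∈ im H¹(K_w, T)`**,
the local condition `𝓕_can` at the places `w ∣ N`, `w ∤ pr` ([Rubin00] Thm. 4.5.1 / [MR04]
Thm. 3.2.4), with NO hypothesis on `T` at `w`.  Proof: the Mackey formula (file 1) makes
`res_D Cor κ_i` a sum of `cor^D_{D′} y_q`, `D′ = D ∩ Gal(K̄/K_i)`, `y_q = res_{D′} (t_q⁻¹ · κ_i)`;
`res_H y_q` (`H = D′ ∩ Gal(K̄/K(r)) ≤ Gal(K̄/K_i(r))`) is `red_*` of a `T`-class by §1, hence so is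
`[D′ : H] y_q = cor_{D′/H} res_H y_q` (`cores_resSubgroup`, naturality of `cor`), hence
so is `y_q = a [D′ : H] y_q` (`M` kills `H¹(D′, T′)`), and `cor`, `toSubgroupOf`, `res` are natural
in the coefficients (file 1 §1, F3a).
[cite: Rubin2000, Thm. 4.5.1] [cite: MazurRubin2004, Thm. 3.2.4 and App. A Prop. A.2] -/
theorem exists_map_red_eq_resSubgroup_cores (red : T.toTopRep ⟶ T'.toTopRep) (i : ι)
    [Fintype (absoluteGaloisGroup K ⧸ L.pLevel i)] (r : L.Ideals)
    (σ : HeightOneSpectrum (𝓞 K) → absoluteGaloisGroup K) (N : HeightOneSpectrum (𝓞 K) → ℕ) (comm)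
    (κi : continuousCohomology 1 (subgroupRep T'.toTopRep (L.pLevel i)))
    (hκi : resLe T'.toTopRep (level_le_pLevel L i r.1) 1 κi =
        (r.1.noncommProd (fun ℓ => ∑ j ∈ range (N ℓ), (j : Module.End A (continuousCohomology 1
          (subgroupRep T'.toTopRep (L.level i r.1)))) *
          (conjMap T'.toTopRep (L.level i r.1) (σ ℓ) 1).hom.toLinearMap ^ j) comm)
        (ContinuousCohomology.map (ContinuousMonoidHom.id _) (X := subgroupRep T.toTopRep (L.level i r.1))
          (Y := subgroupRep T'.toTopRep (L.level i r.1))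
          ((TopRep.resFunctor (L.level i r.1).subtype).map red) 1 (c i r)))
    (D : Subgroup (absoluteGaloisGroup K)) [Fintype (absoluteGaloisGroup K ⧸ (D ⊔ L.pLevel i))]
    [Fintype (D ⧸ (D ⊓ L.pLevel i).subgroupOf D)]
    [Fintype ((D ⊓ L.pLevel i : Subgroup (absoluteGaloisGroup K)) ⧸
      (D ⊓ L.pLevel i ⊓ L.level ⊥ r.1).subgroupOf (D ⊓ L.pLevel i))]
    (a : A) (ha : ∀ v : M',
      (a * (((D ⊓ L.pLevel i ⊓ L.level ⊥ r.1).subgroupOf (D ⊓ L.pLevel i)).index : A)) • v = v) :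
    ∃ z : continuousCohomology 1 (subgroupRep T.toTopRep D),
      ContinuousCohomology.map (ContinuousMonoidHom.id D) (X := subgroupRep T.toTopRep D)
        (Y := subgroupRep T'.toTopRep D) ((TopRep.resFunctor D.subtype).map red) 1 z =
      resSubgroup T'.toTopRep D 1 (cores T'.toTopRep (L.pLevel i) (L.isOpen_pLevel i) κi) := by
  classical
  haveI : (L.pLevel i).Normal :=
    Subgroup.Normal.of_commutator_le (absoluteGaloisGroup K) (L.commutator_le_pLevel i)
  -- `D′ = D ∩ Γ_i`, `H = D′ ∩ U_{⊥,r} ≤ U_{i,r}`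
  have hHD' : D ⊓ L.pLevel i ⊓ L.level ⊥ r.1 ≤ D ⊓ L.pLevel i := inf_le_left
  have hHU : D ⊓ L.pLevel i ⊓ L.level ⊥ r.1 ≤ L.level i r.1 := fun g hg =>
    L.mem_level_iff.mpr ⟨hg.1.2, (L.mem_level_iff.mp hg.2).2⟩
  have hHo : IsOpen ((((D ⊓ L.pLevel i ⊓ L.level ⊥ r.1).subgroupOf (D ⊓ L.pLevel i) :
      Subgroup (D ⊓ L.pLevel i : Subgroup (absoluteGaloisGroup K))) :
        Set (D ⊓ L.pLevel i : Subgroup (absoluteGaloisGroup K)))) := by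
    have e : ((((D ⊓ L.pLevel i ⊓ L.level ⊥ r.1).subgroupOf (D ⊓ L.pLevel i) :
        Subgroup (D ⊓ L.pLevel i : Subgroup (absoluteGaloisGroup K))) :
          Set (D ⊓ L.pLevel i : Subgroup (absoluteGaloisGroup K)))) =
        Subtype.val ⁻¹' (L.level ⊥ r.1 : Set (absoluteGaloisGroup K)) := by
      ext x
      simp only [SetLike.mem_coe, Subgroup.mem_subgroupOf, Subgroup.mem_inf, Set.mem_preimage,
        SetLike.coe_mem, true_and]
    rw [e]
    exact (L.isOpen_level ⊥ r.1).preimage continuous_subtype_val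
  have hD'o : IsOpen (((D ⊓ L.pLevel i).subgroupOf D : Subgroup D) : Set D) := by
    have e : (((D ⊓ L.pLevel i).subgroupOf D : Subgroup D) : Set D) =
        Subtype.val ⁻¹' (L.pLevel i : Set (absoluteGaloisGroup K)) := by
      ext x
      simp only [SetLike.mem_coe, Subgroup.mem_subgroupOf, Subgroup.mem_inf, Set.mem_preimage,
        SetLike.coe_mem, true_and]
    rw [e]
    exact (L.isOpen_pLevel i).preimage continuous_subtype_val
  have ht : ∀ q : absoluteGaloisGroup K ⧸ (D ⊔ L.pLevel i),
      ((Quotient.out q : absoluteGaloisGroup K) : absoluteGaloisGroup K ⧸ (D ⊔ L.pLevel i)) = q :=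
    QuotientGroup.out_eq'
  -- `M′` is killed by `a · [D′ : H] − 1`
  have hkill : ∀ y : continuousCohomology 1 (subgroupRep T'.toTopRep (D ⊓ L.pLevel i)),
      (a * (((D ⊓ L.pLevel i ⊓ L.level ⊥ r.1).subgroupOf (D ⊓ L.pLevel i)).index : A)) • y = y := by
    intro y
    have h := smul_eq_zero_of_forall_smul_eq_zero T'.toTopRep
      (a * (((D ⊓ L.pLevel i ⊓ L.level ⊥ r.1).subgroupOf (D ⊓ L.pLevel i)).index : A) - 1)
      (fun v => by rw [sub_smul, one_smul, sub_eq_zero]; exact ha v) y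
    rwa [sub_smul, one_smul, sub_eq_zero] at h
  -- the coefficient change at `D` as a linear map, and its range
  set F := (ContinuousCohomology.map (ContinuousMonoidHom.id D) (X := subgroupRep T.toTopRep D)
    (Y := subgroupRep T'.toTopRep D) ((TopRep.resFunctor D.subtype).map red) 1).hom.toLinearMap
    with hF
  suffices hmem : resSubgroup T'.toTopRep D 1 (cores T'.toTopRep (L.pLevel i) (L.isOpen_pLevel i) κi) ∈
      LinearMap.range F by
    obtain ⟨z, hz⟩ := hmem
    exact ⟨z, hz⟩
  rw [Mackey.resSubgroup_cores_eq_sum_cores T'.toTopRep (L.pLevel i) D (D ⊓ L.pLevel i) inf_le_left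
    inf_le_right (fun g hg hgi => ⟨hg, hgi⟩) (L.isOpen_pLevel i) hD'o ht κi]
  refine Submodule.sum_mem _ fun q _ => ?_
  -- `W`: the `T`-class `D_r ((t_q)⁻¹ · c_{i,r})` restricted to `H`
  set W := resLe T.toTopRep hHU 1
    ((r.1.noncommProd (fun ℓ => ∑ j ∈ range (N ℓ), (j : Module.End A (continuousCohomology 1
      (subgroupRep T.toTopRep (L.level i r.1)))) *
      (conjMap T.toTopRep (L.level i r.1) (σ ℓ) 1).hom.toLinearMap ^ j)
      (pairwise_commute_deriv i r.1 σ N))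
      (conjMap T.toTopRep (L.level i r.1) (Quotient.out q)⁻¹ 1 (c i r))) with hW
  -- `y_q = red_* (a • cor_{D′/H} W)`
  have h1 : resLe T'.toTopRep (inf_le_right : D ⊓ L.pLevel i ≤ L.pLevel i) 1
      (conjMap T'.toTopRep (L.pLevel i) (Quotient.out q)⁻¹ 1 κi) =
      ContinuousCohomology.map (ContinuousMonoidHom.id _)
        (X := subgroupRep T.toTopRep (D ⊓ L.pLevel i)) (Y := subgroupRep T'.toTopRep (D ⊓ L.pLevel i))
        ((TopRep.resFunctor (D ⊓ L.pLevel i).subtype).map red) 1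
        (a • cores (subgroupRep T.toTopRep (D ⊓ L.pLevel i))
          ((D ⊓ L.pLevel i ⊓ L.level ⊥ r.1).subgroupOf (D ⊓ L.pLevel i)) hHo
          (toSubgroupOf T.toTopRep hHD' 1 W)) := by
    rw [← hkill (resLe T'.toTopRep _ 1 _), ← smul_smul,
      ← cores_resSubgroup (subgroupRep T'.toTopRep (D ⊓ L.pLevel i)) _ hHo,
      ← toSubgroupOf_resLe T'.toTopRep hHD', resLe_resLe,
      ← resLe_resLe T'.toTopRep hHU (level_le_pLevel L i r.1),
      resLe_conjMap_eq_map_red_deriv red i r σ N comm κi hκi, ← red_resLe, ← hW,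
      ← Mackey.map_toSubgroupOf, ← Mackey.cohomologyMap_cores, cohomologyMap_resFunctor_map,
      ← map_smul]
  rw [h1]
  refine ⟨cores (subgroupRep T.toTopRep D) ((D ⊓ L.pLevel i).subgroupOf D) hD'o
    (toSubgroupOf T.toTopRep inf_le_left 1 (a • cores (subgroupRep T.toTopRep (D ⊓ L.pLevel i))
      ((D ⊓ L.pLevel i ⊓ L.level ⊥ r.1).subgroupOf (D ⊓ L.pLevel i)) hHo
      (toSubgroupOf T.toTopRep hHD' 1 W))), ?_⟩
  rw [hF]
  change ContinuousCohomology.map (ContinuousMonoidHom.id D) (X := subgroupRep T.toTopRep D)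
    (Y := subgroupRep T'.toTopRep D) ((TopRep.resFunctor D.subtype).map red) 1 _ = _
  rw [← cohomologyMap_resFunctor_map, Mackey.cohomologyMap_cores, Mackey.map_toSubgroupOf]

/-- Double restriction `Γ → D → H` read on `D`: `res_{H∩D} (res_D κ) = toSubgroupOf (res_H κ)`.
[folklore] -/
theorem resSubgroup_resSubgroup_eq_toSubgroupOf {R : Type v} [CommRing R] [TopologicalSpace R]
    {G : Type u} [Group G] [TopologicalSpace G] [IsTopologicalGroup G] (X : TopRep.{u} R G)
    {H D : Subgroup G} (h : H ≤ D) (κ : continuousCohomology 1 X) :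
    resSubgroup (subgroupRep X D) (H.subgroupOf D) 1 (resSubgroup X D 1 κ) =
      toSubgroupOf X h 1 (resSubgroup X H 1 κ) := by
  obtain ⟨φ, rfl⟩ := oneCocycleClass_surjective _ κ
  rw [resSubgroup_oneCocycleClass, resSubgroup_oneCocycleClass, resSubgroup_oneCocycleClass,
    toSubgroupOf, map_oneCocycleClass]
  exact congrArg _ (Subtype.ext (ContinuousMap.ext fun _ => rfl))

/-- **THEOREM (bottom layer, prime-to-`p` local degree; no `K_∞`-direction needed).**  Let
`κ ∈ H¹(K, T′)` restrict on `Gal(K̄/K(r))` to `D_r (red_* c_{⊥,r})` (F4/F5's `κ_r`) and let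
`D ≤ Γ_K` be a subgroup such that the index of `D ∩ Gal(K̄/K(r))` in `D` acts invertibly on `T′`
(`ha`; for a decomposition group `D = D_w`, `w ∉ r`: the residue degree of `w` in `K(r)` is prime to
`p` — over `ℚ`, `p ∤ ord(w mod ∏ ℓ)`, guaranteed when the Kolyvagin primes `ℓ` are chosen with
`w` a `p^{v_p(ℓ-1)}`-th power residue mod `ℓ`).  Then `res_D κ = red_* z` for some `z ∈ H¹(D, T)`:
`[D : H] res_D κ = cor_{D/H} res_H κ = cor_{D/H} res (red_* D_r c) = red_* (…)` and
`res_D κ = a [D:H] res_D κ`.  The `K_∞`-direction (file 2) is needed only to absorb the `p`-part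
of the local degree (`exists_map_red_eq_resSubgroup_cores`).
[cite: Rubin2000, Thm. 4.5.1] [cite: MazurRubin2004, Thm. 3.2.4 and App. A Prop. A.2] -/
theorem exists_map_red_eq_resSubgroup_of_index (red : T.toTopRep ⟶ T'.toTopRep) (r : L.Ideals)
    (σ : HeightOneSpectrum (𝓞 K) → absoluteGaloisGroup K) (N : HeightOneSpectrum (𝓞 K) → ℕ) (comm)
    (κ : continuousCohomology 1 T'.toTopRep)
    (hκ : resSubgroup T'.toTopRep (L.level ⊥ r.1) 1 κ =
        (r.1.noncommProd (fun ℓ => ∑ j ∈ range (N ℓ), (j : Module.End A (continuousCohomology 1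
          (subgroupRep T'.toTopRep (L.level ⊥ r.1)))) *
          (conjMap T'.toTopRep (L.level ⊥ r.1) (σ ℓ) 1).hom.toLinearMap ^ j) comm)
        (ContinuousCohomology.map (ContinuousMonoidHom.id _) (X := subgroupRep T.toTopRep (L.level ⊥ r.1))
          (Y := subgroupRep T'.toTopRep (L.level ⊥ r.1))
          ((TopRep.resFunctor (L.level ⊥ r.1).subtype).map red) 1 (c ⊥ r)))
    (D : Subgroup (absoluteGaloisGroup K))
    [Fintype (D ⧸ (D ⊓ L.level ⊥ r.1).subgroupOf D)]
    (a : A) (ha : ∀ v : M', (a * (((D ⊓ L.level ⊥ r.1).subgroupOf D).index : A)) • v = v) :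
    ∃ z : continuousCohomology 1 (subgroupRep T.toTopRep D),
      ContinuousCohomology.map (ContinuousMonoidHom.id D) (X := subgroupRep T.toTopRep D)
        (Y := subgroupRep T'.toTopRep D) ((TopRep.resFunctor D.subtype).map red) 1 z =
      resSubgroup T'.toTopRep D 1 κ := by
  classical
  have hHD : D ⊓ L.level ⊥ r.1 ≤ D := inf_le_left
  have hHU : D ⊓ L.level ⊥ r.1 ≤ L.level ⊥ r.1 := inf_le_right
  have hHo : IsOpen ((((D ⊓ L.level ⊥ r.1).subgroupOf D : Subgroup D)) : Set D) := by
    have e : ((((D ⊓ L.level ⊥ r.1).subgroupOf D : Subgroup D)) : Set D) =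
        Subtype.val ⁻¹' (L.level ⊥ r.1 : Set (absoluteGaloisGroup K)) := by
      ext x
      simp only [SetLike.mem_coe, Subgroup.mem_subgroupOf, Subgroup.mem_inf, Set.mem_preimage,
        SetLike.coe_mem, true_and]
    rw [e]
    exact (L.isOpen_level ⊥ r.1).preimage continuous_subtype_val
  have hkill : ∀ y : continuousCohomology 1 (subgroupRep T'.toTopRep D),
      (a * (((D ⊓ L.level ⊥ r.1).subgroupOf D).index : A)) • y = y := by
    intro y
    have h := smul_eq_zero_of_forall_smul_eq_zero T'.toTopRep
      (a * (((D ⊓ L.level ⊥ r.1).subgroupOf D).index : A) - 1)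
      (fun v => by rw [sub_smul, one_smul, sub_eq_zero]; exact ha v) y
    rwa [sub_smul, one_smul, sub_eq_zero] at h
  refine ⟨a • cores (subgroupRep T.toTopRep D) ((D ⊓ L.level ⊥ r.1).subgroupOf D) hHo
    (toSubgroupOf T.toTopRep hHD 1 (resLe T.toTopRep hHU 1
      ((r.1.noncommProd (fun ℓ => ∑ j ∈ range (N ℓ), (j : Module.End A (continuousCohomology 1
        (subgroupRep T.toTopRep (L.level ⊥ r.1)))) *
        (conjMap T.toTopRep (L.level ⊥ r.1) (σ ℓ) 1).hom.toLinearMap ^ j)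
        (pairwise_commute_deriv ⊥ r.1 σ N)) (c ⊥ r)))), ?_⟩
  rw [map_smul, ← cohomologyMap_resFunctor_map, Mackey.cohomologyMap_cores, Mackey.map_toSubgroupOf,
    red_resLe, map_red_deriv_comm (L.level ⊥ r.1) red r.1 σ N (pairwise_commute_deriv ⊥ r.1 σ N) comm,
    ← hκ, resLe_resSubgroup, ← resSubgroup_resSubgroup_eq_toSubgroupOf, cores_resSubgroup,
    smul_smul, hkill]

end LocalImage

end Derivative

end Summit.BirchSwinnertonDyer.Rank1Residual.GaloisImage

end
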